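import Summits.QuantumFields.BalabanUV.Beta.EriceRemainderEnclosureHistoryAutonomyWellPosed

/-!
# EriceRemainderEnclosureHistoryAutonomyThreshold — (E38a) THE EXACT CONSTANT OF THE AUTONOMY THRESHOLD, LOWER SIDE `3√3`: two box solutions
# of the flow with memory of a functional with ZEROTH MOMENT `M` and floor `b` on ]0,γ] from one pin COINCIDE under the CLOSED condition
# `M·γ ≤ 3√3·b`, and the solution map is an `M·γ∕(3√3·b)`-contraction — (E37h)'s `5∕2` raised to `3√3 ≈ 5.196` by the sharp sensitivity
# `|a − a′| ≤ c³∕2·|1∕a² − 1∕a′²|` on ]0,c] (node U2's `Sharpness.abs_sub_le_half_cube_mul`; here also STRICT for `a ≠ a′`) in place of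
# `|a − a′| ≤ a²a′·|1∕a² − 1∕a′²|`, and the sharp absorption `27·X·t² ≤ 4(X+t)³` (equality at `t = 2X`) in place of `25·X·t² ≤ 4(X+t)³`:
# `sup_m m·(1∕γ² + m·b)^{−3∕2}∕2 = γ∕(3√3·b)`.  Every non-unique instance has `3√3·b < M·γ` STRICTLY.  With the companions (E38b)
# `…HistoryAutonomyThresholdWellPosed` (stability ∕ existence ∕ `∃!` under `M·γ < 3√3·b`) and (E38c) `…HistoryAutonomyThresholdWitness` (a Markov
# tent family at `bγ² = 2` with two box solutions at EVERY ratio `M·γ∕b > 3√3`) the threshold constant is PINNED: `τ* = 3√3`, not attained, the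
# same for genuine memory as for the Markov sub-class ((E37i)) — (E37g)∕(E37h)'s bracket `[5∕2, 10]` collapses to the point `3√3`

Cell `pub-balaban`, β-function sub-cell, BINDER row D4 «RemainderConst leaves for Bałaban's split» (`HOME/BINDER-OWNERS.md`; owner
lineage `b2b-balaban-beta-an4`; this file by co-owner #2 lineage `b2b-balaban-beta-d4-p2`, generation 40), β-FLOW TEAM duty (1),
FREEZE (0) honoured (def-free; node U2's `MemFlow` ∕ `drive` ∕ `picard`, its profile-free §§1–2 lemmas and `Sharpness.abs_sub_le_half_cube_mul`,
(E37b)'s `abs_drive_sub_drive_le_zm` BY NAME, nothing restated).  Companion of (E37b) `…HistoryAutonomyWellPosed` (imported), (E37h)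
`…HistoryAutonomyConstant` (`2M·γ < 5b`), (E37g) `…HistoryAutonomyDegree` (degree one in γ; node U2's bump at ratio `10`), (E37i)
`…HistoryAutonomyMarkovFloor` (Markov: `L·γ < 3√3·b`).

HONEST FRAMING (page 1, verbatim and binding).  *"Discharging BetaPertH makes Bałaban's UV stability UNCONDITIONAL — a real
constructive-QFT result; it is NOT the continuum limit and NOT the Clay problem."*  THIS FILE DISCHARGES NOTHING OF THE KIND.  Pure real
analysis about an ABSTRACT functional `B : (ℕ → ℝ) → ℝ` with displayed zeroth moment `M` and floor `b` on the box ]0,γ]^ℕ — hypotheses, not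
facts; which modulus Bałaban's limit functional has is NOT PRINTED ([I] p. 298: the dependence on the preceding couplings exists, qualitatively)
and not asserted.  Row D4 class UNCHANGED (critical-path width 0; instance 0∕1; D4 DISCHARGE NO DATE).  HONEST DEPENDENCY: continuum YM on T⁴ ⇐
BetaPertH ∧ nine spine estimates (0/9 proved); BetaPertH ⇐ (D1) ∧ (D4) ∧ CAP+tail; G-an2-4 gates asym, D1 and NE2/3/4.

THE POINT (census sense (α); the AUTONOMY row of the history channel, its constant).  Two box solutions `h, h′` of one flow from one pin have
recursion variables `1∕h_j² = 1∕g_IR² + drive B h j` whose discrepancy after `j` scales is at most `j·M·Δ`, `Δ = sup_i |h_i − h′_i|` (the zeroth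
moment, (E37b)'s `abs_drive_sub_drive_le_zm`); BOTH values at scale `j` lie in the sub-box ]0, c_j], `c_j = (1∕g_IR² + j·b)^{−1∕2}` (asymptotic
freedom with the floor), where `|a − a′| ≤ c_j³∕2·|1∕a² − 1∕a′²|`; and `j·c_j³∕2 ≤ γ∕(3√3·b)` for every `j` (§1: `27Xt² ≤ 4(X+t)³`, `X = 1∕γ²`,
`t = j·b`).  Hence `Δ ≤ (M·γ∕(3√3·b))·Δ` and the solution map is an `M·γ∕(3√3·b)`-contraction (§2).  For UNIQUENESS the closed condition
suffices (§3): `|h_j − h′_j| ≤ c_j → 0`, so the supremum is attained at some `j⋆` with `h_{j⋆} ≠ h′_{j⋆}`, where the sensitivity inequality is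
STRICT (`2a²a′² < c³(a + a′)` unless `a = a′`), giving `Δ < Δ` under `M·γ ≤ 3√3·b`.  Census: the AUTONOMY row's well-posedness threshold is the
zeroth moment with the constant `3√3` exactly (with (E38c)); long memory does NOT lower it below the Markov value, and (E37h)'s `5∕2` was the
price of the factor-2 loss in `T4CouplingMatching.abs_sub_le_of_inv_sq`, not of the problem.  NOT claimed: existence at or beyond
`M·γ = 3√3·b` ((E33) supplies existence rows-only without any threshold); a floor-FREE statement (node U2's §9); anything about Bałaban's (1.22).

WHAT IS PROVED ([folklore]; 0 `def`, 0 sorry; suffix `_zs` = «zeroth moment, sharp constant»).  §1 `cubic_absorption_27`, `three_sqrt_three_sq`,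
`three_sqrt_three_pos`, **`weight_sharp_le`** (`m·(1∕√P)³∕2 ≤ γ∕(3√3·b)`, `P = 1∕γ² + m·b`), `le_inv_sqrt_of_le_inv_sq`, `inv_sqrt_le_of_inv_sq_le`,
**`abs_sub_lt_half_cube_mul`** (strict sensitivity).  §2 **`abs_picard_sub_le_core_zs`** (`≤ γ³∕2·|1∕gIR² − 1∕gIR′²| + (γ∕(3√3b))·η +
(M·γ∕(3√3b))·D`), **`picard_contraction_zs`**, `contraction_const_zs`.  §3 `abs_sub_le_invSqrt_of_memFlow`, **`memFlow_unique_zs_closed`**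
(`M·γ ≤ 3√3·b`), **`ratio_gt_of_two_solutions`** (`h ≠ h′ ⟹ 3√3·b < M·γ`).
-/

noncomputable section
open Filter Topology Finset

namespace Summit.QuantumFields.BalabanUV.Beta.EriceRemainderEnclosureHistoryAutonomyThreshold

open Literature.MathematicalPhysics.QuantumFieldTheory.Balaban1983to89
open Literature.MathematicalPhysics.QuantumFieldTheory.Balaban1983to89.T4ContinuumCoupling (tendsto_of_abs_sub_le_geom)
open Literature.MathematicalPhysics.QuantumFieldTheory.Balaban1983to89.T4BetaStationary
open Literature.MathematicalPhysics.QuantumFieldTheory.Balaban1983to89.T4BetaFlowWellPosed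
open Literature.MathematicalPhysics.QuantumFieldTheory.Balaban1983to89.T4BetaFlowWellPosed.Sharpness (abs_sub_le_half_cube_mul)
open Summit.QuantumFields.BalabanUV.Beta.EriceRemainderEnclosureHistoryAutonomyWellPosed

variable {B B' : (ℕ → ℝ) → ℝ} {M γ b η gIR gIR' : ℝ} {h h' : ℕ → ℝ}

/-! ## §1 The sharp absorption and the sharp sensitivity -/

/-- THE SHARP CUBIC ABSORPTION: `27·X·t² ≤ 4·(X + t)³` for `X, t ≥ 0` (`4(X+t)³ − 27Xt² = (t − 2X)²(4t + X)`; equality at `t = 2X`). [folklore] -/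
theorem cubic_absorption_27 {X t : ℝ} (hX : 0 ≤ X) (ht : 0 ≤ t) : 27 * X * t ^ 2 ≤ 4 * (X + t) ^ 3 := by
  nlinarith [mul_nonneg (sq_nonneg (t - 2 * X)) (by linarith : (0 : ℝ) ≤ 4 * t + X)]

/-- `(3·√3)² = 27`. [folklore] -/
theorem three_sqrt_three_sq : (3 * Real.sqrt 3) ^ 2 = 27 := by
  rw [mul_pow, Real.sq_sqrt (by norm_num : (0 : ℝ) ≤ 3)]; norm_num

/-- `0 < 3·√3`. [folklore] -/
theorem three_sqrt_three_pos : 0 < 3 * Real.sqrt 3 := by positivity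

/-- **THE SHARP WEIGHT BOUND**: with `P = 1∕γ² + m·b` (`γ, b > 0`), `m·(1∕√P)³∕2 ≤ γ∕(3√3·b)` — the supremum over the scale of the linear growth
`m` against the asymptotic-freedom weight `c_m³∕2 = P^{−3∕2}∕2` is `γ∕(3√3·b)`, at `m·b = 2∕γ²`. [folklore] -/
theorem weight_sharp_le (hγ : 0 < γ) (hb : 0 < b) (m : ℕ) :
    (m : ℝ) * ((1 / Real.sqrt (1 / γ ^ 2 + (m : ℝ) * b)) ^ 3 / 2) ≤ γ / (3 * Real.sqrt 3 * b) := by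
  set P : ℝ := 1 / γ ^ 2 + (m : ℝ) * b with hP
  have hX : (0 : ℝ) ≤ 1 / γ ^ 2 := by positivity
  have hmb : (0 : ℝ) ≤ (m : ℝ) * b := mul_nonneg (Nat.cast_nonneg m) hb.le
  have hP0 : 0 < P := by positivity
  have hsP : 0 < Real.sqrt P := Real.sqrt_pos.2 hP0
  have e1 : (1 / Real.sqrt P) ^ 3 = 1 / (P * Real.sqrt P) := by
    rw [div_pow, one_pow, pow_succ, Real.sq_sqrt hP0.le]
  rw [e1, show (m : ℝ) * (1 / (P * Real.sqrt P) / 2) = (m : ℝ) / (2 * (P * Real.sqrt P)) by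
      field_simp,
    div_le_div_iff₀ (by positivity) (by positivity)]
  -- square both sides: 27·(m b)² ≤ 4·γ²·P³
  have h3 : Real.sqrt 3 ^ 2 = 3 := Real.sq_sqrt (by norm_num)
  have hsq : ((m : ℝ) * (3 * Real.sqrt 3 * b)) ^ 2 ≤ (γ * (2 * (P * Real.sqrt P))) ^ 2 := by
    have e2 : ((m : ℝ) * (3 * Real.sqrt 3 * b)) ^ 2 = 27 * ((m : ℝ) * b) ^ 2 := by
      have : ((m : ℝ) * (3 * Real.sqrt 3 * b)) ^ 2 = 9 * Real.sqrt 3 ^ 2 * ((m : ℝ) * b) ^ 2 := by ring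
      rw [this, h3]; ring
    have e3 : (γ * (2 * (P * Real.sqrt P))) ^ 2 = 4 * γ ^ 2 * P ^ 3 := by
      have : (γ * (2 * (P * Real.sqrt P))) ^ 2 = 4 * γ ^ 2 * P ^ 2 * Real.sqrt P ^ 2 := by ring
      rw [this, Real.sq_sqrt hP0.le]; ring
    have hcub := cubic_absorption_27 hX hmb
    have h4 : γ ^ 2 * (27 * (1 / γ ^ 2) * ((m : ℝ) * b) ^ 2) ≤ γ ^ 2 * (4 * (1 / γ ^ 2 + (m : ℝ) * b) ^ 3) :=
      mul_le_mul_of_nonneg_left hcub (by positivity)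
    have e4 : γ ^ 2 * (27 * (1 / γ ^ 2) * ((m : ℝ) * b) ^ 2) = 27 * ((m : ℝ) * b) ^ 2 := by
      field_simp
    have e5 : γ ^ 2 * (4 * (1 / γ ^ 2 + (m : ℝ) * b) ^ 3) = 4 * γ ^ 2 * P ^ 3 := by rw [hP]; ring
    rw [e2, e3]
    linarith [h4, e4, e5]
  exact (pow_le_pow_iff_left₀ (by positivity) (by positivity) two_ne_zero).1 hsq

/-- Envelope in coupling form: `P ≤ 1∕a²` (`a, P > 0`) gives `a ≤ 1∕√P`. [folklore] -/
theorem le_inv_sqrt_of_le_inv_sq {a P : ℝ} (ha : 0 < a) (hP : 0 < P) (haP : P ≤ 1 / a ^ 2) : a ≤ 1 / Real.sqrt P := by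
  have := one_div_sqrt_anti hP haP
  rwa [one_div_sqrt_one_div_sq ha] at this

/-- … and `1∕γ² ≤ P` gives `1∕√P ≤ γ`. [folklore] -/
theorem inv_sqrt_le_of_inv_sq_le {P : ℝ} (hγ : 0 < γ) (hγP : 1 / γ ^ 2 ≤ P) : 1 / Real.sqrt P ≤ γ :=
  one_div_sqrt_le hγ hγP

/-- **STRICT SHARP SENSITIVITY**: `0 < a, a′ ≤ C`, `a ≠ a′` ⟹ `|a − a′| < C³∕2·|1∕a² − 1∕a′²|` (`2a²a′² < C³(a + a′)` since `a·a′ < C²` when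
`a ≠ a′`; node U2's `abs_sub_le_half_cube_mul` is the non-strict form). [folklore] -/
theorem abs_sub_lt_half_cube_mul {a a' C : ℝ} (ha : 0 < a) (ha' : 0 < a') (haC : a ≤ C) (ha'C : a' ≤ C) (hne : a ≠ a') :
    |a - a'| < C ^ 3 / 2 * |1 / a ^ 2 - 1 / a' ^ 2| := by
  have e : 1 / a ^ 2 - 1 / a' ^ 2 = (a' - a) * ((a' + a) / (a ^ 2 * a' ^ 2)) := by
    field_simp
    ring
  rw [e, abs_mul, abs_of_pos (by positivity : 0 < (a' + a) / (a ^ 2 * a' ^ 2)), abs_sub_comm a' a]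
  have hprod : a * a' < C * C := by
    rcases lt_or_gt_of_ne hne with hlt | hlt
    · calc a * a' < a' * a' := mul_lt_mul_of_pos_right hlt ha'
        _ ≤ C * C := mul_le_mul ha'C ha'C ha'.le (ha'.le.trans ha'C)
    · calc a * a' < a * a := mul_lt_mul_of_pos_left hlt ha
        _ ≤ C * C := mul_le_mul haC haC ha.le (ha.le.trans haC)
  have hC : 0 < C := lt_of_lt_of_le ha haC
  have h1 : a ^ 2 * a' ^ 2 < C ^ 2 * (a * a') := by
    have := mul_lt_mul_of_pos_right hprod (mul_pos ha ha')
    nlinarith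
  have h2 : 2 * (a * a') ≤ C * (a' + a) := by
    nlinarith [mul_nonneg (sub_nonneg.2 haC) ha'.le, mul_nonneg (sub_nonneg.2 ha'C) ha.le]
  have h3 : 2 * (a ^ 2 * a' ^ 2) < C ^ 3 * (a' + a) := by
    calc 2 * (a ^ 2 * a' ^ 2) < 2 * (C ^ 2 * (a * a')) := by linarith
      _ = C ^ 2 * (2 * (a * a')) := by ring
      _ ≤ C ^ 2 * (C * (a' + a)) := mul_le_mul_of_nonneg_left h2 (by positivity)
      _ = C ^ 3 * (a' + a) := by ring
  have key : 1 < C ^ 3 / 2 * ((a' + a) / (a ^ 2 * a' ^ 2)) := by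
    rw [show C ^ 3 / 2 * ((a' + a) / (a ^ 2 * a' ^ 2)) = C ^ 3 * (a' + a) / (2 * (a ^ 2 * a' ^ 2)) by ring,
      lt_div_iff₀ (by positivity), one_mul]
    exact h3
  have hpos : 0 < |a - a'| := abs_pos.2 (sub_ne_zero.2 hne)
  calc |a - a'| = |a - a'| * 1 := (mul_one _).symm
    _ < |a - a'| * (C ^ 3 / 2 * ((a' + a) / (a ^ 2 * a' ^ 2))) := mul_lt_mul_of_pos_left key hpos
    _ = C ^ 3 / 2 * (|a - a'| * ((a' + a) / (a ^ 2 * a' ^ 2))) := by ring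

/-! ## §2 The core estimate and the contraction with the sharp constant -/

/-- **THE CORE ESTIMATE, SHARP**: `B` with zeroth moment `M ≥ 0`, `B` AND `B′` with floor `b > 0` on the box ]0,γ], `B′` within `η` of `B`;
pins `gIR, gIR′ ∈ ]0,γ]`; box histories `h, h′` entrywise `D`-close; `a′ > 0` with `1∕a′² = 1∕gIR′² + drive B′ h′ m`.  Then
`|picard B gIR h m − a′| ≤ γ³∕2·|1∕gIR² − 1∕gIR′²| + (γ∕(3√3·b))·η + (M·γ∕(3√3·b))·D`. [folklore] -/
theorem abs_picard_sub_le_core_zs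
    (hB : ∀ u u' : ℕ → ℝ, SeqBox γ u → SeqBox γ u' → ∀ D : ℝ, (∀ j, |u j - u' j| ≤ D) → |B u - B u'| ≤ M * D)
    (hM : 0 ≤ M) (hgIR : 0 < gIR) (hgIRγ : gIR ≤ γ) (hgIR' : 0 < gIR') (hgIR'γ : gIR' ≤ γ) (hb : 0 < b)
    (hlo : ∀ u, SeqBox γ u → b ≤ B u) (hlo' : ∀ u, SeqBox γ u → b ≤ B' u)
    (hη : ∀ u, SeqBox γ u → |B u - B' u| ≤ η) (hh : SeqBox γ h) (hh' : SeqBox γ h') {D : ℝ}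
    (hD : ∀ i, |h i - h' i| ≤ D) (m : ℕ) {a' : ℝ} (ha' : 0 < a')
    (hSa' : 1 / a' ^ 2 = 1 / gIR' ^ 2 + drive B' h' m) :
    |picard B gIR h m - a'|
      ≤ γ ^ 3 / 2 * |1 / gIR ^ 2 - 1 / gIR' ^ 2| + γ / (3 * Real.sqrt 3 * b) * η + M * γ / (3 * Real.sqrt 3 * b) * D := by
  have hγ : 0 < γ := lt_of_lt_of_le hgIR hgIRγ
  have hη0 : 0 ≤ η := (abs_nonneg _).trans (hη _ (seqBox_const hγ))
  have hD0 : 0 ≤ D := (abs_nonneg _).trans (hD 0)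
  set a := picard B gIR h m with ha_def
  have ha : 0 < a := picard_pos hgIR hb hlo hh m
  have hSa : 1 / a ^ 2 = 1 / gIR ^ 2 + drive B h m := one_div_picard_sq hgIR hb hlo hh m
  set P : ℝ := 1 / γ ^ 2 + (m : ℝ) * b with hP
  have hmb : (0 : ℝ) ≤ (m : ℝ) * b := mul_nonneg (Nat.cast_nonneg m) hb.le
  have hP0 : 0 < P := by positivity
  -- both values obey the envelope at scale m
  have hpin : 1 / γ ^ 2 ≤ 1 / gIR ^ 2 := one_div_le_one_div_of_le (by positivity) (pow_le_pow_left₀ hgIR.le hgIRγ 2)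
  have hpin' : 1 / γ ^ 2 ≤ 1 / gIR' ^ 2 := one_div_le_one_div_of_le (by positivity) (pow_le_pow_left₀ hgIR'.le hgIR'γ 2)
  have haP : P ≤ 1 / a ^ 2 := by
    rw [hSa]; exact add_le_add hpin (mul_lower_le_drive hlo hh m)
  have ha'P : P ≤ 1 / a' ^ 2 := by
    rw [hSa']; exact add_le_add hpin' (mul_lower_le_drive hlo' hh' m)
  set C : ℝ := 1 / Real.sqrt P with hC
  have haC : a ≤ C := le_inv_sqrt_of_le_inv_sq ha hP0 haP
  have ha'C : a' ≤ C := le_inv_sqrt_of_le_inv_sq ha' hP0 ha'P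
  have hCγ : C ≤ γ := inv_sqrt_le_of_inv_sq_le hγ (le_add_of_nonneg_right hmb)
  have hC0 : 0 < C := lt_of_lt_of_le ha haC
  have hw := abs_sub_le_half_cube_mul ha ha' haC ha'C
  have hdiff : |1 / a ^ 2 - 1 / a' ^ 2| ≤ |1 / gIR ^ 2 - 1 / gIR' ^ 2| + (m : ℝ) * (M * D + η) := by
    rw [hSa, hSa']
    calc |1 / gIR ^ 2 + drive B h m - (1 / gIR' ^ 2 + drive B' h' m)|
        = |(1 / gIR ^ 2 - 1 / gIR' ^ 2) + (drive B h m - drive B' h' m)| := by ring_nf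
      _ ≤ |1 / gIR ^ 2 - 1 / gIR' ^ 2| + |drive B h m - drive B' h' m| := abs_add_le _ _
      _ ≤ |1 / gIR ^ 2 - 1 / gIR' ^ 2| + (m : ℝ) * (M * D + η) :=
          add_le_add le_rfl (abs_drive_sub_drive_le_zm hB hη hh hh' hD m)
  have hW1 : C ^ 3 / 2 ≤ γ ^ 3 / 2 :=
    div_le_div_of_nonneg_right (pow_le_pow_left₀ hC0.le hCγ 3) (by norm_num)
  have hW2 : (m : ℝ) * (C ^ 3 / 2) ≤ γ / (3 * Real.sqrt 3 * b) := weight_sharp_le hγ hb m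
  have hΔ0 : 0 ≤ |1 / gIR ^ 2 - 1 / gIR' ^ 2| := abs_nonneg _
  have hE0 : 0 ≤ M * D + η := by positivity
  calc |a - a'| ≤ C ^ 3 / 2 * |1 / a ^ 2 - 1 / a' ^ 2| := hw
    _ ≤ C ^ 3 / 2 * (|1 / gIR ^ 2 - 1 / gIR' ^ 2| + (m : ℝ) * (M * D + η)) :=
        mul_le_mul_of_nonneg_left hdiff (by positivity)
    _ = C ^ 3 / 2 * |1 / gIR ^ 2 - 1 / gIR' ^ 2| + (m : ℝ) * (C ^ 3 / 2) * (M * D + η) := by ring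
    _ ≤ γ ^ 3 / 2 * |1 / gIR ^ 2 - 1 / gIR' ^ 2| + γ / (3 * Real.sqrt 3 * b) * (M * D + η) :=
        add_le_add (mul_le_mul_of_nonneg_right hW1 hΔ0) (mul_le_mul_of_nonneg_right hW2 hE0)
    _ = γ ^ 3 / 2 * |1 / gIR ^ 2 - 1 / gIR' ^ 2| + γ / (3 * Real.sqrt 3 * b) * η
        + M * γ / (3 * Real.sqrt 3 * b) * D := by ring

/-- **THE SOLUTION MAP IS AN `M·γ∕(3√3·b)`-CONTRACTION IN THE SUPREMUM DISTANCE ON THE BOX.** [folklore] -/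
theorem picard_contraction_zs
    (hB : ∀ u u' : ℕ → ℝ, SeqBox γ u → SeqBox γ u' → ∀ D : ℝ, (∀ j, |u j - u' j| ≤ D) → |B u - B u'| ≤ M * D)
    (hM : 0 ≤ M) (hgIR : 0 < gIR) (hgIRγ : gIR ≤ γ) (hb : 0 < b) (hlo : ∀ u, SeqBox γ u → b ≤ B u) (hh : SeqBox γ h)
    (hh' : SeqBox γ h') {D : ℝ} (hD : ∀ i, |h i - h' i| ≤ D) (m : ℕ) :
    |picard B gIR h m - picard B gIR h' m| ≤ M * γ / (3 * Real.sqrt 3 * b) * D := by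
  have h0 : ∀ u, SeqBox γ u → |B u - B u| ≤ 0 := fun u _ => by simp
  have := abs_picard_sub_le_core_zs hB hM hgIR hgIRγ hgIR hgIRγ hb hlo hlo h0 hh hh' hD m
    (picard_pos hgIR hb hlo hh' m) (one_div_picard_sq hgIR hb hlo hh' m)
  simpa using this

/-- The sharp contraction constant is in `[0,1[` under `M·γ < 3√3·b`. [folklore] -/
theorem contraction_const_zs (hM : 0 ≤ M) (hγ : 0 ≤ γ) (hb : 0 < b) (hsmall : M * γ < 3 * Real.sqrt 3 * b) :
    0 ≤ M * γ / (3 * Real.sqrt 3 * b) ∧ M * γ / (3 * Real.sqrt 3 * b) < 1 :=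
  ⟨div_nonneg (by positivity) (by positivity), (div_lt_one (by positivity)).2 hsmall⟩

/-! ## §3 The closed threshold for uniqueness: `M·γ ≤ 3√3·b` -/

/-- THE SUB-BOX OF A SOLUTION PAIR: two box solutions of flows with floor `b` from one pin satisfy, at every scale,
`|h j − h′ j| ≤ 1∕√(1∕gIR² + j·b)` (both values lie in ]0, c_j]). [folklore] -/
theorem abs_sub_le_invSqrt_of_memFlow (hb : 0 < b) (hgIR : 0 < gIR)
    (hlo : ∀ u, SeqBox γ u → b ≤ B u) (hlo' : ∀ u, SeqBox γ u → b ≤ B' u) (hh : SeqBox γ h) (hh' : SeqBox γ h')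
    (hf : MemFlow B gIR h) (hf' : MemFlow B' gIR h') (j : ℕ) :
    |h j - h' j| ≤ 1 / Real.sqrt (1 / gIR ^ 2 + (j : ℝ) * b) := by
  have hP0 : 0 < 1 / gIR ^ 2 + (j : ℝ) * b := by
    have : (0 : ℝ) ≤ (j : ℝ) * b := mul_nonneg (Nat.cast_nonneg j) hb.le
    positivity
  have e1 : ∀ {x : ℝ}, 0 < x → x ^ 2 ≤ 1 / (1 / gIR ^ 2 + (j : ℝ) * b) → x ≤ 1 / Real.sqrt (1 / gIR ^ 2 + (j : ℝ) * b) := by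
    intro x hx hx2
    refine le_inv_sqrt_of_le_inv_sq hx hP0 ?_
    have := one_div_le_one_div_of_le (by positivity) hx2
    rwa [one_div_one_div] at this
  exact abs_sub_le_of_nonneg_of_le (hh j).1.le (e1 (hh j).1 (memFlow_sq_le hlo hb hgIR hh hf j)) (hh' j).1.le
    (e1 (hh' j).1 (memFlow_sq_le hlo' hb hgIR hh' hf' j))

/-- **UNIQUENESS UNDER THE CLOSED CONDITION `M·γ ≤ 3√3·b`.**  Two box solutions of one flow (zeroth moment `M`, floor `b > 0` on ]0,γ]) from
one pin `gIR ∈ ]0,γ]` coincide.  Proof: `|h j − h′ j| ≤ c_j → 0`, so the supremum `Δ` of the discrepancy is ATTAINED at a scale `j⋆`; if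
`Δ > 0` then `h j⋆ ≠ h′ j⋆` and the strict sensitivity gives `Δ < (j⋆·c_{j⋆}³∕2)·M·Δ ≤ (M·γ∕(3√3·b))·Δ ≤ Δ`. [folklore] -/
theorem memFlow_unique_zs_closed
    (hB : ∀ u u' : ℕ → ℝ, SeqBox γ u → SeqBox γ u' → ∀ D : ℝ, (∀ j, |u j - u' j| ≤ D) → |B u - B u'| ≤ M * D)
    (hM : 0 ≤ M) (hgIR : 0 < gIR) (hgIRγ : gIR ≤ γ) (hb : 0 < b) (hlo : ∀ u, SeqBox γ u → b ≤ B u)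
    (hsmall : M * γ ≤ 3 * Real.sqrt 3 * b) (hh : SeqBox γ h) (hh' : SeqBox γ h') (hf : MemFlow B gIR h)
    (hf' : MemFlow B gIR h') : h = h' := by
  have hγ : 0 < γ := lt_of_lt_of_le hgIR hgIRγ
  by_contra hne
  obtain ⟨j₀, hj₀⟩ : ∃ j, h j ≠ h' j := Function.ne_iff.mp hne
  set δ : ℕ → ℝ := fun j => |h j - h' j| with hδ
  have hδ0 : 0 < δ j₀ := abs_pos.2 (sub_ne_zero.2 hj₀)
  -- the envelope: δ j ≤ c_j = 1/√(1/gIR² + j b) ≤ 1/√(j b)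
  have henv : ∀ j, δ j ≤ 1 / Real.sqrt (1 / gIR ^ 2 + (j : ℝ) * b) := fun j =>
    abs_sub_le_invSqrt_of_memFlow hb hgIR hlo hlo hh hh' hf hf' j
  -- beyond the scale J the envelope is below δ j₀
  obtain ⟨J, hJ⟩ : ∃ J : ℕ, 1 / (b * δ j₀ ^ 2) < J := exists_nat_gt _
  have hfar : ∀ j, J < j → δ j < δ j₀ := by
    intro j hj
    have hjb : 1 / δ j₀ ^ 2 < (j : ℝ) * b := by
      have h1 : 1 / (b * δ j₀ ^ 2) < (j : ℝ) := hJ.trans (by exact_mod_cast hj)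
      rw [div_lt_iff₀ (by positivity)] at h1
      rw [div_lt_iff₀ (by positivity)]
      linarith
    have hP : 1 / δ j₀ ^ 2 < 1 / gIR ^ 2 + (j : ℝ) * b := lt_of_lt_of_le hjb (le_add_of_nonneg_left (by positivity))
    have hlt : 1 / Real.sqrt (1 / gIR ^ 2 + (j : ℝ) * b) < δ j₀ := by
      rw [div_lt_iff₀ (Real.sqrt_pos.2 (lt_trans (by positivity) hP)), ← div_lt_iff₀' hδ0]
      rw [show 1 / δ j₀ = Real.sqrt (1 / δ j₀ ^ 2) by
        rw [← one_div_pow, Real.sqrt_sq (by positivity)]]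
      exact Real.sqrt_lt_sqrt (by positivity) hP
    exact (henv j).trans_lt hlt
  have hj₀J : j₀ ≤ J := not_lt.1 fun hlt => lt_irrefl _ (hfar j₀ hlt)
  -- the supremum is attained on the finite window `j ≤ J`
  obtain ⟨jS, hjS, hmax⟩ := exists_max_image (range (J + 1)) δ ⟨0, by simp⟩
  have hΔ : ∀ j, δ j ≤ δ jS := by
    intro j
    by_cases hj : j ≤ J
    · exact hmax j (mem_range.2 (Nat.lt_succ_of_le hj))
    · exact (hfar j (not_le.1 hj)).le.trans (hmax j₀ (mem_range.2 (Nat.lt_succ_of_le hj₀J)))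
  have hΔpos : 0 < δ jS := hδ0.trans_le (hΔ j₀)
  have hneS : h jS ≠ h' jS := fun e => by simp [hδ, e] at hΔpos
  -- the chain at the scale jS
  set P : ℝ := 1 / γ ^ 2 + (jS : ℝ) * b with hP
  have hmb : (0 : ℝ) ≤ (jS : ℝ) * b := mul_nonneg (Nat.cast_nonneg jS) hb.le
  have hP0 : 0 < P := by positivity
  have hpin : 1 / γ ^ 2 ≤ 1 / gIR ^ 2 := one_div_le_one_div_of_le (by positivity) (pow_le_pow_left₀ hgIR.le hgIRγ 2)
  have hSa : 1 / h jS ^ 2 = 1 / gIR ^ 2 + drive B h jS := invSq_eq_of_memFlow hf jS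
  have hSa' : 1 / h' jS ^ 2 = 1 / gIR ^ 2 + drive B h' jS := invSq_eq_of_memFlow hf' jS
  have haP : P ≤ 1 / h jS ^ 2 := by rw [hSa]; exact add_le_add hpin (mul_lower_le_drive hlo hh jS)
  have ha'P : P ≤ 1 / h' jS ^ 2 := by rw [hSa']; exact add_le_add hpin (mul_lower_le_drive hlo hh' jS)
  set C : ℝ := 1 / Real.sqrt P with hC
  have haC : h jS ≤ C := le_inv_sqrt_of_le_inv_sq (hh jS).1 hP0 haP
  have ha'C : h' jS ≤ C := le_inv_sqrt_of_le_inv_sq (hh' jS).1 hP0 ha'P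
  have hstrict := abs_sub_lt_half_cube_mul (hh jS).1 (hh' jS).1 haC ha'C hneS
  have h0 : ∀ u, SeqBox γ u → |B u - B u| ≤ 0 := fun u _ => by simp
  have hdiff : |1 / h jS ^ 2 - 1 / h' jS ^ 2| ≤ (jS : ℝ) * (M * δ jS + 0) := by
    rw [hSa, hSa', show 1 / gIR ^ 2 + drive B h jS - (1 / gIR ^ 2 + drive B h' jS) = drive B h jS - drive B h' jS by ring]
    exact abs_drive_sub_drive_le_zm hB h0 hh hh' hΔ jS
  have hW2 : (jS : ℝ) * (C ^ 3 / 2) ≤ γ / (3 * Real.sqrt 3 * b) := weight_sharp_le hγ hb jS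
  have hC0 : 0 < C := lt_of_lt_of_le (hh jS).1 haC
  have hratio : M * γ / (3 * Real.sqrt 3 * b) ≤ 1 := by
    rw [div_le_one (by positivity)]; exact hsmall
  have hMΔ : 0 ≤ M * δ jS := mul_nonneg hM hΔpos.le
  have key : δ jS < δ jS := by
    calc δ jS = |h jS - h' jS| := rfl
      _ < C ^ 3 / 2 * |1 / h jS ^ 2 - 1 / h' jS ^ 2| := hstrict
      _ ≤ C ^ 3 / 2 * ((jS : ℝ) * (M * δ jS + 0)) := mul_le_mul_of_nonneg_left hdiff (by positivity)
      _ = (jS : ℝ) * (C ^ 3 / 2) * (M * δ jS) := by ring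
      _ ≤ γ / (3 * Real.sqrt 3 * b) * (M * δ jS) := mul_le_mul_of_nonneg_right hW2 hMΔ
      _ = M * γ / (3 * Real.sqrt 3 * b) * δ jS := by ring
      _ ≤ 1 * δ jS := mul_le_mul_of_nonneg_right hratio hΔpos.le
      _ = δ jS := one_mul _
  exact lt_irrefl _ key

/-- **EVERY NON-UNIQUE INSTANCE HAS `3√3·b < M·γ` STRICTLY**: two distinct box solutions of one flow (zeroth moment `M`, floor `b`) from one pin
force the ratio `M·γ∕b` strictly above `3√3` — with (E38b)'s witnesses at every ratio above `3√3`, the threshold constant is `3√3` exactly and is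
NOT attained. [folklore] -/
theorem ratio_gt_of_two_solutions
    (hB : ∀ u u' : ℕ → ℝ, SeqBox γ u → SeqBox γ u' → ∀ D : ℝ, (∀ j, |u j - u' j| ≤ D) → |B u - B u'| ≤ M * D)
    (hM : 0 ≤ M) (hgIR : 0 < gIR) (hgIRγ : gIR ≤ γ) (hb : 0 < b) (hlo : ∀ u, SeqBox γ u → b ≤ B u)
    (hh : SeqBox γ h) (hh' : SeqBox γ h') (hf : MemFlow B gIR h) (hf' : MemFlow B gIR h') (hne : h ≠ h') :
    3 * Real.sqrt 3 * b < M * γ :=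
  not_le.1 fun hsmall => hne (memFlow_unique_zs_closed hB hM hgIR hgIRγ hb hlo hsmall hh hh' hf hf')

end Summit.QuantumFields.BalabanUV.Beta.EriceRemainderEnclosureHistoryAutonomyThreshold

end
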